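import Summits.QuantumFields.YangMills.Theorems.UnitScaleTiltHalvingP1FlatCoreTopTargetTrace
import Summits.QuantumFields.YangMills.Theorems.UnitScaleTiltHalvingP1FlatCoreTopTargetReads
import HarnessLib

/-!
# Line H (`BirthV10.stub_halvingStep`, stmt-QuantumFields-19200), J4c (T4b)∕τ-thread: **THE TRACE-FREE TARGET FROM READ-TERRITORY DATA** — the `hthτ` binder of the
# τ-twin socket ✓`P1FlatCoreTopStepTorus.hFP_kLevel_top_RD_traceFree` ((τ-3)) for the target of ✓`P1FlatCoreTopTargetRep.exists_topTarget_of_axialT_of_reads`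
# ((D)-reads, ★w8-19936 g3), i.e. ✓`exists_topTarget_of_axialT_traceFree` with `W₁` near `1` ∕ unitary ∕ `det = 1` asked ONLY on the fine bonds read by the combs

Cell `ym3-torus` (HUMAN RULING D-0037: YM₃ on T³ is ladder rung R3, NOT the Clay problem), width seat `ym-ust-19936-w3` (gen 7; τ-thread (τ-1) + feeds; ★w8-19936 g3 16:20:29Z «GO»).
`--supports stmt-QuantumFields-19200 --as helper`; THEOREMS ONLY (0 `def`, 0 `sorry`); count-neutral; nothing here claims `core′`, `hSupU`, the stub, the crux or the gap.

WHAT IS PROVED (ns `…P1FlatCoreTopTargetRep`, next to ✓`…TopTargetTrace` and ✓`…TopTargetReads`):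
* §1 `det_axialT_dbarIterU_eq_one_of_reads` — `det v₀(W̿₁^{(k)}; y₀, x) = 1` from `det = 1` fine data on the bonds whose `k`-blocks lie in a set `S` containing the comb
  `Γ_{y₀,x}` (✓`Prop8ChartDoubleBar.holT_pred_of_walk` ∘ ✓`det_dbarIterU_eq_one_of_reads` at `S`); `trCLM_mlog_axialT_eq_zero_of_reads` (+ guard `‖v₀ − 1‖ ≤ 1∕3`,
  lit ✓`ExpMeanLog.trace_mlog_eq_zero_of_det_eq_one`).
* §2 ★ `exists_topTarget_of_axialT_traceFree_of_unitary` — the target with its FIVE clauses (skew, `= log v₀` on `Λ`, zero below the top, `‖th‖ ≤ τ`, `∀ p, tr (th p) = 0`)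
  from the two pointwise rows `v₀ ∈ U(2)` and `tr log v₀ = 0` on `Λ` (✓`P1FlatCoreTopDictionary.exists_topTarget` incl. its support clause);
  ★★ `exists_topTarget_of_axialT_traceFree_of_reads` — ✓`exists_topTarget_of_axialT_of_reads`'s binders VERBATIM + `hdet` on the same read territory ⟹ the five clauses
  (= ✓`exists_topTarget_of_axialT_traceFree` with `hW₁`∕`hWu`∕`hdet` localised to `S`; for the H-line's member `S :=` the top cube, `hS :=` ✓`P1FlatCoreTopCubeWalks.walk_treeWord_subset_Om_top`).
HONEST SCOPE.  Bookkeeping over landed letters; no estimate; nothing of [Balaban1985RegularSpaces] Sect. E is proved here.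

References: T. Bałaban, CMP **99** (1985) 75–102 [Balaban1985RegularSpaces] (p.76, (1.17) p.78, Sect. E (1.91)–(1.92) p.98); CMP **98** (1985) 17–51 [Balaban1985Averaging]
((8)–(9) pp.18–19, (20)–(23) p.21, p.24, Prop. 4 (134)–(135) p.38); CMP **109** (1987) 249–301 [Balaban1987RG1] (before (0.5) p.253).
-/

set_option autoImplicit false

noncomputable section

open scoped BigOperators Matrix.Norms.L2Operator

namespace Summit.QuantumFields.YangMills.Theorems.P1FlatCoreTopTargetRep

open Literature.MathematicalPhysics.QuantumFieldTheory.Balaban1983to89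
open T4Continuum MatrixLog
open B14DomainGeom (Pt)
open Node00 (coverAt)
open B7Prop1Explicit (treeWord)
open B5Eq118OneStroke (iterBlockOf)
open B10Eq27TorusAxialLog (rel axialT holT)
open B8Eq1117Concrete (XSpace)
open ExpMeanLog (star_mlog_eq_neg trace_mlog_eq_zero_of_det_eq_one)
open B8SpecialUnitaryTrace (trCLM trCLM_apply)
open Summit.QuantumFields.YangMills.Theorems.Prop8ChartDoubleBar (dbarIterU holT_pred_of_walk det_dbarIterU_eq_one_of_reads det_coe_units_inv_eq_one
  two_mul_lt_pi_of_le_third)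
open Summit.QuantumFields.YangMills.Theorems.P1FlatCoreTopDictionary (exists_topTarget)

variable {P : Params}

/-! ## §1 `det v₀ = 1` and `tr log v₀ = 0` from read-territory data -/

section Det

/-- **`det v₀(W̿₁^{(k)}; y₀, x) = 1` FROM THE READ TERRITORY**: `W₁` within `s₀` of `1` and of determinant one on the fine bonds whose `k`-blocks lie in `S`
(`8·3800·((d+2)L)²·Lᵏ·s₀ ≤ 1`), every bond of the comb `Γ_{y₀,x}` with both ends in `S` ⇒ `det v₀ = 1` (each comb bond's double-bar variable has `det = 1` by
✓`det_dbarIterU_eq_one_of_reads`, products∕inverses by ✓`holT_pred_of_walk`) — det-twin of ✓`axialT_dbarIterU_mem_unitaryGroup_of_reads`.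
[cite: Balaban1985Averaging, (8)-(9) pp.18-19, p.24; Balaban1987RG1, before (0.5) p.253] -/
theorem det_axialT_dbarIterU_eq_one_of_reads {k : ℕ} (hk : k ≤ P.m + P.K) (S : Set (Site P k))
    (W₁ : GaugeField P 0 (Matrix (Fin 2) (Fin 2) ℂ)ˣ) {s₀ : ℝ} (hs₀ : 0 ≤ s₀)
    (hbudget : 8 * 3800 * (((P.d + 2) * P.L : ℕ) : ℝ) ^ 2 * (P.L : ℝ) ^ k * s₀ ≤ 1)
    (hW₁ : ∀ b : PBond P 0, iterBlockOf k b.src ∈ S → iterBlockOf k b.tgt ∈ S →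
      ‖((W₁ b : (Matrix (Fin 2) (Fin 2) ℂ)ˣ) : Matrix (Fin 2) (Fin 2) ℂ) - 1‖ ≤ s₀)
    (hdet : ∀ b : PBond P 0, iterBlockOf k b.src ∈ S → iterBlockOf k b.tgt ∈ S →
      ((W₁ b : (Matrix (Fin 2) (Fin 2) ℂ)ˣ) : Matrix (Fin 2) (Fin 2) ℂ).det = 1)
    (y₀ x : Site P k) (hS : ∀ st ∈ walk y₀ (treeWord (rel y₀ x)), st.bond.src ∈ S ∧ st.bond.tgt ∈ S) :
    ((axialT (dbarIterU k W₁) y₀ x : (Matrix (Fin 2) (Fin 2) ℂ)ˣ) : Matrix (Fin 2) (Fin 2) ℂ).det = 1 := by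
  unfold axialT
  exact holT_pred_of_walk (fun a : (Matrix (Fin 2) (Fin 2) ℂ)ˣ => (a : Matrix (Fin 2) (Fin 2) ℂ).det = 1)
    (by rw [Units.val_one, Matrix.det_one]) (fun a b ha hb => by rw [Units.val_mul, Matrix.det_mul, ha, hb, one_mul])
    (fun a ha => det_coe_units_inv_eq_one ha) (dbarIterU k W₁) y₀ (treeWord (rel y₀ x)) fun st hst =>
      det_dbarIterU_eq_one_of_reads hk S W₁ hs₀ hbudget hW₁ hdet st.bond (hS st hst).1 (hS st hst).2

/-- **`tr log v₀(W̿₁^{(k)}; y₀, x) = 0` FROM THE READ TERRITORY** (§1 `det = 1` + the guard `‖v₀ − 1‖ ≤ 1∕3`, lit ✓`trace_mlog_eq_zero_of_det_eq_one`,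
✓`two_mul_lt_pi_of_le_third`). [cite: Balaban1985RegularSpaces, p.76, (1.17) p.78; Balaban1985Averaging, (20)-(23) p.21, p.24] -/
theorem trCLM_mlog_axialT_eq_zero_of_reads {k : ℕ} (hk : k ≤ P.m + P.K) (S : Set (Site P k))
    (W₁ : GaugeField P 0 (Matrix (Fin 2) (Fin 2) ℂ)ˣ) {s₀ : ℝ} (hs₀ : 0 ≤ s₀)
    (hbudget : 8 * 3800 * (((P.d + 2) * P.L : ℕ) : ℝ) ^ 2 * (P.L : ℝ) ^ k * s₀ ≤ 1)
    (hW₁ : ∀ b : PBond P 0, iterBlockOf k b.src ∈ S → iterBlockOf k b.tgt ∈ S →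
      ‖((W₁ b : (Matrix (Fin 2) (Fin 2) ℂ)ˣ) : Matrix (Fin 2) (Fin 2) ℂ) - 1‖ ≤ s₀)
    (hdet : ∀ b : PBond P 0, iterBlockOf k b.src ∈ S → iterBlockOf k b.tgt ∈ S →
      ((W₁ b : (Matrix (Fin 2) (Fin 2) ℂ)ˣ) : Matrix (Fin 2) (Fin 2) ℂ).det = 1)
    (y₀ x : Site P k) (hS : ∀ st ∈ walk y₀ (treeWord (rel y₀ x)), st.bond.src ∈ S ∧ st.bond.tgt ∈ S)
    (hsm : ‖((axialT (dbarIterU k W₁) y₀ x : (Matrix (Fin 2) (Fin 2) ℂ)ˣ) : Matrix (Fin 2) (Fin 2) ℂ) - 1‖ ≤ 1 / 3) :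
    trCLM (Fin 2) (mlog ((axialT (dbarIterU k W₁) y₀ x : (Matrix (Fin 2) (Fin 2) ℂ)ˣ) : Matrix (Fin 2) (Fin 2) ℂ)) = 0 := by
  rw [trCLM_apply]
  exact trace_mlog_eq_zero_of_det_eq_one (det_axialT_dbarIterU_eq_one_of_reads hk S W₁ hs₀ hbudget hW₁ hdet y₀ x hS) hsm
    (two_mul_lt_pi_of_le_third hsm)

end Det

/-! ## §2 The trace-free target from read-territory data -/

section Target

/-- ★ **THE TRACE-FREE TARGET FROM THE TWO POINTWISE ROWS ON `Λ`**: if on `Λ` the axial transporters `v₀(W̿₁^{(k)}; y₀, π_k yc)` are unitary, trace-free in the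
logarithm and within `τ∕2 ≤ 1∕3` of `1`, there is `th : XSpace d k M₂(ℂ)` — skew, `= log v₀` on the top labels of `Λ`, zero below the top, `‖th‖ ≤ τ`, and trace-free
EVERYWHERE (✓`exists_topTarget`, all five of its clauses used; the support clause gives `th = 0` off `Λ` at the top).
[cite: Balaban1985RegularSpaces, p.76, (1.17) p.78, Sect. E (1.91)-(1.92) p.98; Balaban1985Averaging, (23) p.21, p.24] -/
theorem exists_topTarget_of_axialT_traceFree_of_unitary {k : ℕ} (W₁ : GaugeField P 0 (Matrix (Fin 2) (Fin 2) ℂ)ˣ)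
    (y₀ : Site P k) (Λ : Set (Pt P.d)) {τ : ℝ} (hτ : 0 ≤ τ) (hτ3 : τ ≤ 2 / 3)
    (haxU : ∀ yc ∈ Λ, ((axialT (dbarIterU k W₁) y₀ (coverAt P k yc) : (Matrix (Fin 2) (Fin 2) ℂ)ˣ) : Matrix (Fin 2) (Fin 2) ℂ) ∈
      Matrix.unitaryGroup (Fin 2) ℂ)
    (haxτ : ∀ yc ∈ Λ, trCLM (Fin 2) (mlog ((axialT (dbarIterU k W₁) y₀ (coverAt P k yc) : (Matrix (Fin 2) (Fin 2) ℂ)ˣ) : Matrix (Fin 2) (Fin 2) ℂ)) = 0)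
    (hsmall : ∀ yc ∈ Λ, ‖((axialT (dbarIterU k W₁) y₀ (coverAt P k yc) : (Matrix (Fin 2) (Fin 2) ℂ)ˣ) : Matrix (Fin 2) (Fin 2) ℂ) - 1‖ ≤ τ / 2) :
    ∃ th : XSpace P.d k (Matrix (Fin 2) (Fin 2) ℂ),
      (∀ p, star (th p) = -th p) ∧
      (∀ yc ∈ Λ, th (⟨k, Nat.lt_succ_self k⟩, yc) =
        mlog ((axialT (dbarIterU k W₁) y₀ (coverAt P k yc) : (Matrix (Fin 2) (Fin 2) ℂ)ˣ) : Matrix (Fin 2) (Fin 2) ℂ)) ∧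
      (∀ (j : ℕ) (hj : j < k) (y : Pt P.d), th (⟨j, Nat.lt_succ_of_lt hj⟩, y) = 0) ∧
      ‖th‖ ≤ τ ∧
      (∀ p, trCLM (Fin 2) (th p) = 0) := by
  have ht : ∀ yc ∈ Λ, ‖mlog ((axialT (dbarIterU k W₁) y₀ (coverAt P k yc) : (Matrix (Fin 2) (Fin 2) ℂ)ˣ) : Matrix (Fin 2) (Fin 2) ℂ)‖ ≤ τ :=
    fun yc hyc => (norm_mlog_le_two_mul ((hsmall yc hyc).trans (by linarith))).trans (by linarith [hsmall yc hyc])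
  have hskew : ∀ yc ∈ Λ, star (mlog ((axialT (dbarIterU k W₁) y₀ (coverAt P k yc) : (Matrix (Fin 2) (Fin 2) ℂ)ˣ) : Matrix (Fin 2) (Fin 2) ℂ)) =
      -mlog ((axialT (dbarIterU k W₁) y₀ (coverAt P k yc) : (Matrix (Fin 2) (Fin 2) ℂ)ˣ) : Matrix (Fin 2) (Fin 2) ℂ) := fun yc hyc =>
    star_mlog_eq_neg (haxU yc hyc) ((hsmall yc hyc).trans (by linarith))
  obtain ⟨th, h1, h2, h3, h4, h5⟩ := exists_topTarget k Λ
    (fun yc => mlog ((axialT (dbarIterU k W₁) y₀ (coverAt P k yc) : (Matrix (Fin 2) (Fin 2) ℂ)ˣ) : Matrix (Fin 2) (Fin 2) ℂ)) hτ ht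
  refine ⟨th, h5 hskew, h1, h2, h4, fun p => ?_⟩
  obtain ⟨q, y⟩ := p
  by_cases hqk : (q : ℕ) = k
  · have hq : q = ⟨k, Nat.lt_succ_self k⟩ := Fin.ext hqk
    rw [hq]
    by_cases hy : y ∈ Λ
    · rw [h1 y hy]; exact haxτ y hy
    · rw [h3 y hy, map_zero]
  · have hlt : (q : ℕ) < k := lt_of_le_of_ne (Nat.lt_succ_iff.mp q.isLt) hqk
    have hq : q = ⟨(q : ℕ), Nat.lt_succ_of_lt hlt⟩ := Fin.ext rfl
    rw [hq, h2 (q : ℕ) hlt y, map_zero]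

/-- ★★ **THE TRACE-FREE TARGET OF THE TOP STEP FROM READ-TERRITORY DATA** — ✓`exists_topTarget_of_axialT_of_reads`'s binders VERBATIM + `hdet : det W₁(b) = 1` on the
same read territory ⟹ its four clauses ∧ `∀ p, tr (th p) = 0` (the `hthτ` binder of ✓`hFP_kLevel_top_RD_traceFree` at `τ := trCLM (Fin 2)` for the same `th`):
unitarity of the axial transporters by ✓`axialT_dbarIterU_mem_unitaryGroup_of_reads`, `tr log v₀ = 0` by §1 under the guard `τ∕2 ≤ 1∕3` already in the binders.
[cite: Balaban1985RegularSpaces, p.76, (1.17) p.78, Sect. E (1.91)-(1.92) p.98; Balaban1985Averaging, (8)-(9) pp.18-19, (23) p.21, p.24] -/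
theorem exists_topTarget_of_axialT_traceFree_of_reads {k : ℕ} (hk : k ≤ P.m + P.K) (S : Set (Site P k))
    (W₁ : GaugeField P 0 (Matrix (Fin 2) (Fin 2) ℂ)ˣ)
    {s₀ : ℝ} (hs₀ : 0 ≤ s₀) (hbudget : 8 * 3800 * (((P.d + 2) * P.L : ℕ) : ℝ) ^ 2 * (P.L : ℝ) ^ k * s₀ ≤ 1)
    (hW₁ : ∀ b : PBond P 0, iterBlockOf k b.src ∈ S → iterBlockOf k b.tgt ∈ S →
      ‖((W₁ b : (Matrix (Fin 2) (Fin 2) ℂ)ˣ) : Matrix (Fin 2) (Fin 2) ℂ) - 1‖ ≤ s₀)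
    (hWu : ∀ b : PBond P 0, iterBlockOf k b.src ∈ S → iterBlockOf k b.tgt ∈ S →
      ((W₁ b : (Matrix (Fin 2) (Fin 2) ℂ)ˣ) : Matrix (Fin 2) (Fin 2) ℂ) ∈ Matrix.unitaryGroup (Fin 2) ℂ)
    (hdet : ∀ b : PBond P 0, iterBlockOf k b.src ∈ S → iterBlockOf k b.tgt ∈ S →
      ((W₁ b : (Matrix (Fin 2) (Fin 2) ℂ)ˣ) : Matrix (Fin 2) (Fin 2) ℂ).det = 1)
    (y₀ : Site P k) (Λ : Set (Pt P.d))
    (hS : ∀ yc ∈ Λ, ∀ st ∈ walk y₀ (treeWord (rel y₀ (coverAt P k yc))), st.bond.src ∈ S ∧ st.bond.tgt ∈ S)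
    {τ : ℝ} (hτ : 0 ≤ τ) (hτ3 : τ ≤ 2 / 3)
    (hsmall : ∀ yc ∈ Λ, ‖((axialT (dbarIterU k W₁) y₀ (coverAt P k yc) : (Matrix (Fin 2) (Fin 2) ℂ)ˣ) : Matrix (Fin 2) (Fin 2) ℂ) - 1‖ ≤ τ / 2) :
    ∃ th : XSpace P.d k (Matrix (Fin 2) (Fin 2) ℂ),
      (∀ p, star (th p) = -th p) ∧
      (∀ yc ∈ Λ, th (⟨k, Nat.lt_succ_self k⟩, yc) =
        mlog ((axialT (dbarIterU k W₁) y₀ (coverAt P k yc) : (Matrix (Fin 2) (Fin 2) ℂ)ˣ) : Matrix (Fin 2) (Fin 2) ℂ)) ∧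
      (∀ (j : ℕ) (hj : j < k) (y : Pt P.d), th (⟨j, Nat.lt_succ_of_lt hj⟩, y) = 0) ∧
      ‖th‖ ≤ τ ∧
      (∀ p, trCLM (Fin 2) (th p) = 0) :=
  exists_topTarget_of_axialT_traceFree_of_unitary W₁ y₀ Λ hτ hτ3
    (fun yc hyc => axialT_dbarIterU_mem_unitaryGroup_of_reads hk S W₁ hs₀ hbudget hW₁ hWu y₀ (coverAt P k yc) (hS yc hyc))
    (fun yc hyc => trCLM_mlog_axialT_eq_zero_of_reads hk S W₁ hs₀ hbudget hW₁ hdet y₀ (coverAt P k yc) (hS yc hyc)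
      ((hsmall yc hyc).trans (by linarith)))
    hsmall

end Target

end Summit.QuantumFields.YangMills.Theorems.P1FlatCoreTopTargetRep

end
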